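import Summits.CriticalPhenomena.PercolationContinuityZ3.Theorems.PercNearOneGluingNoHeavyLowerTailIncStarWDOMTwoProngedCore
import HarnessLib

/-!
# W-domination at a TWO-PRONGED root, part 2: the theorem (Sahi programme, prover prim-sahi-p2 gen 34)

Support file (`--supports stmt-CriticalPhenomena-4575`).  No definitions, no named facts, no sorries; standard axioms.  Memo
`run/shared/lean/prim/prim-sahi/FROM-prim-sahi-p2-gen34-WDOM.md` §6; part 1 (`…IncStarWDOMTwoProngedCore`) has the arithmetic core and the cluster lemma.
**`wdom_twoPronged`**: if the root `s` carries weight `0` on every non-loop pair other than `s(s,i)`, `s(s,j)` (`s,i,j` distinct; the rest of the graph arbitrary),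
then for every up-closed family `𝒜` of vertex sets, `A = {ω | C_s(ω) ∈ 𝒜}`: `2P(A∩B_i∩B_j) − q_jP(A∩B_i) − q_iP(A∩B_j) − (2q_{ij} − 2q_iq_j)P(A) ≥ 0`.
-/

noncomputable section

namespace Summit.CriticalPhenomena.PercolationContinuityZ3.Theorems

namespace IncStar

open MeasureTheory Set Literature.Probability.Percolation Literature.Probability.LatticeModels EdgeInduction
open scoped Classical

variable {n : ℕ}

/-- **W-DOMINATION AT A TWO-PRONGED ROOT.**  Let `s, i, j` be distinct and suppose every non-loop pair at `s` other than `s(s,i)`, `s(s,j)` has weight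
`0`.  Then for every up-closed family `𝒜` of vertex sets, with `A = {ω | C_s(ω) ∈ 𝒜}`, `B_v = {s ↔ v}`, `q_v = P(B_v)`, `q_{ij} = P(B_i ∩ B_j)`:
`2·P(A ∩ B_i ∩ B_j) − q_j·P(A ∩ B_i) − q_i·P(A ∩ B_j) − (2q_{ij} − 2q_iq_j)·P(A) ≥ 0`. [this work] -/
theorem wdom_twoPronged (w : Sym2 (Fin n) → unitInterval) {s i j : Fin n} (his : i ≠ s) (hjs : j ≠ s) (hij : i ≠ j)
    (hroot : ∀ v : Fin n, v ≠ s → v ≠ i → v ≠ j → w s(s, v) = 0)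
    (𝒜 : Set (Set (Fin n))) (h𝒜 : ∀ S T : Set (Fin n), S ∈ 𝒜 → S ⊆ T → T ∈ 𝒜) :
    0 ≤ 2 * (prodBernoulli w).real ({ω | openCluster ω s ∈ 𝒜} ∩ openConn s i ∩ openConn s j)
        - (prodBernoulli w).real (openConn s j) * (prodBernoulli w).real ({ω | openCluster ω s ∈ 𝒜} ∩ openConn s i)
        - (prodBernoulli w).real (openConn s i) * (prodBernoulli w).real ({ω | openCluster ω s ∈ 𝒜} ∩ openConn s j)
        - (2 * (prodBernoulli w).real (openConn s i ∩ openConn s j)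
            - 2 * ((prodBernoulli w).real (openConn s i) * (prodBernoulli w).real (openConn s j)))
          * (prodBernoulli w).real {ω | openCluster ω s ∈ 𝒜} := by
  set e₁ : Sym2 (Fin n) := s(s, i) with he₁
  set e₂ : Sym2 (Fin n) := s(s, j) with he₂
  have hne : e₁ ≠ e₂ := by
    rw [he₁, he₂]; intro h; rw [Sym2.eq_iff] at h
    rcases h with ⟨_, h⟩ | ⟨_, h⟩
    · exact hij h
    · exact his h
  set A : Set (BondConfig (Fin n)) := {ω | openCluster ω s ∈ 𝒜} with hA
  set Bi : Set (BondConfig (Fin n)) := openConn s i with hBi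
  set Bj : Set (BondConfig (Fin n)) := openConn s j with hBj
  have hAup : IsUpperSet A := isUpperSet_clusterMem s h𝒜
  by_cases hbot : ({s} : Set (Fin n)) ∈ 𝒜
  · have hAu : A = Set.univ := by
      ext ω; simp only [hA, Set.mem_setOf_eq, Set.mem_univ, iff_true]
      exact h𝒜 _ _ hbot (by intro y hy; rw [Set.mem_singleton_iff] at hy; subst hy; exact mem_openCluster_self _ _)
    rw [hAu]
    simp only [Set.univ_inter, probReal_univ, mul_one]
    linarith [mul_comm ((prodBernoulli w).real Bj) ((prodBernoulli w).real Bi)]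
  set P00 := pin₂ w e₁ e₂ 0 0 with hP00
  set P01 := pin₂ w e₁ e₂ 0 1 with hP01
  set P10 := pin₂ w e₁ e₂ 1 0 with hP10
  set P11 := pin₂ w e₁ e₂ 1 1 with hP11
  haveI hI00 : IsProbabilityMeasure P00 := by rw [hP00]; unfold pin₂; infer_instance
  haveI hI01 : IsProbabilityMeasure P01 := by rw [hP01]; unfold pin₂; infer_instance
  haveI hI10 : IsProbabilityMeasure P10 := by rw [hP10]; unfold pin₂; infer_instance
  haveI hI11 : IsProbabilityMeasure P11 := by rw [hP11]; unfold pin₂; infer_instance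
  set a : ℝ := (w e₁ : ℝ) with ha
  set b : ℝ := (w e₂ : ℝ) with hb
  have ha0 : 0 ≤ a := (w e₁).2.1
  have ha1 : a ≤ 1 := (w e₁).2.2
  have hb0 : 0 ≤ b := (w e₂).2.1
  have hb1 : b ≤ 1 := (w e₂).2.2
  set D : Set (BondConfig (Fin n)) := {ω | (openGraph (ω \ {e₁, e₂})).Reachable i j} with hD
  have hDup : IsUpperSet D := by
    intro ω ω' hle hω
    exact SimpleGraph.Reachable.mono (openGraph_mono (fun f hf => ⟨hle hf.1, hf.2⟩)) hω
  have hDins : ∀ {e : Sym2 (Fin n)}, (e = e₁ ∨ e = e₂) → ∀ ω : BondConfig (Fin n), insert e ω ∈ D ↔ ω ∈ D := by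
    intro e he ω; simp only [hD, Set.mem_setOf_eq]; rw [insert_diff_rootPairs he]
  have wval := pin₂_update_apply w hne
  have other_ne : ∀ v : Fin n, v ≠ i → v ≠ j → s(s, v) ≠ e₁ ∧ s(s, v) ≠ e₂ := fun v hvi hvj => rootPair_ne_of_ne hvi hvj
  have sure : ∀ (x y : unitInterval), (pin₂ w e₁ e₂ x y).real
      ({ω | ∀ f, Function.update (Function.update w e₁ x) e₂ y f = 1 → f ∈ ω} ∩
        {ω | ∀ f, Function.update (Function.update w e₁ x) e₂ y f = 0 → f ∉ ω}) = 1 := fun x y => real_sureSet _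
  have rootfree : ∀ (x y : unitInterval) (ω : BondConfig (Fin n)),
      ω ∈ ({ω | ∀ f, Function.update (Function.update w e₁ x) e₂ y f = 1 → f ∈ ω} ∩
        {ω | ∀ f, Function.update (Function.update w e₁ x) e₂ y f = 0 → f ∉ ω} : Set (BondConfig (Fin n))) →
      ∀ v : Fin n, v ≠ s → v ≠ i → v ≠ j → s(s, v) ∉ ω := by
    intro x y ω hω v hvs hvi hvj
    apply hω.2
    rw [wval, if_neg (other_ne v hvi hvj).2, if_neg (other_ne v hvi hvj).1]
    exact hroot v hvs hvi hvj
  have mem_one : ∀ (x : unitInterval) (ω : BondConfig (Fin n)),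
      ω ∈ ({ω | ∀ f, Function.update (Function.update w e₁ x) e₂ 1 f = 1 → f ∈ ω} ∩
        {ω | ∀ f, Function.update (Function.update w e₁ x) e₂ 1 f = 0 → f ∉ ω} : Set (BondConfig (Fin n))) → e₂ ∈ ω :=
    fun x ω hω => hω.1 e₂ (by rw [wval, if_pos rfl])
  have nmem_zero : ∀ (x : unitInterval) (ω : BondConfig (Fin n)),
      ω ∈ ({ω | ∀ f, Function.update (Function.update w e₁ x) e₂ 0 f = 1 → f ∈ ω} ∩
        {ω | ∀ f, Function.update (Function.update w e₁ x) e₂ 0 f = 0 → f ∉ ω} : Set (BondConfig (Fin n))) → e₂ ∉ ω :=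
    fun x ω hω => hω.2 e₂ (by rw [wval, if_pos rfl])
  have mem_one₁ : ∀ (y : unitInterval) (ω : BondConfig (Fin n)),
      ω ∈ ({ω | ∀ f, Function.update (Function.update w e₁ 1) e₂ y f = 1 → f ∈ ω} ∩
        {ω | ∀ f, Function.update (Function.update w e₁ 1) e₂ y f = 0 → f ∉ ω} : Set (BondConfig (Fin n))) → e₁ ∈ ω :=
    fun y ω hω => hω.1 e₁ (by rw [wval, if_neg hne, if_pos rfl])
  have nmem_zero₁ : ∀ (y : unitInterval) (ω : BondConfig (Fin n)),
      ω ∈ ({ω | ∀ f, Function.update (Function.update w e₁ 0) e₂ y f = 1 → f ∈ ω} ∩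
        {ω | ∀ f, Function.update (Function.update w e₁ 0) e₂ y f = 0 → f ∉ ω} : Set (BondConfig (Fin n))) → e₁ ∉ ω :=
    fun y ω hω => hω.2 e₁ (by rw [wval, if_neg hne, if_pos rfl])
  set G00 : Set (BondConfig (Fin n)) := {ω | ∀ f, Function.update (Function.update w e₁ 0) e₂ 0 f = 1 → f ∈ ω} ∩
    {ω | ∀ f, Function.update (Function.update w e₁ 0) e₂ 0 f = 0 → f ∉ ω} with hG00
  set G01 : Set (BondConfig (Fin n)) := {ω | ∀ f, Function.update (Function.update w e₁ 0) e₂ 1 f = 1 → f ∈ ω} ∩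
    {ω | ∀ f, Function.update (Function.update w e₁ 0) e₂ 1 f = 0 → f ∉ ω} with hG01
  set G10 : Set (BondConfig (Fin n)) := {ω | ∀ f, Function.update (Function.update w e₁ 1) e₂ 0 f = 1 → f ∈ ω} ∩
    {ω | ∀ f, Function.update (Function.update w e₁ 1) e₂ 0 f = 0 → f ∉ ω} with hG10
  set G11 : Set (BondConfig (Fin n)) := {ω | ∀ f, Function.update (Function.update w e₁ 1) e₂ 1 f = 1 → f ∈ ω} ∩
    {ω | ∀ f, Function.update (Function.update w e₁ 1) e₂ 1 f = 0 → f ∉ ω} with hG11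
  have s00 : P00.real G00 = 1 := sure 0 0
  have s01 : P01.real G01 = 1 := sure 0 1
  have s10 : P10.real G10 = 1 := sure 1 0
  have s11 : P11.real G11 = 1 := sure 1 1
  have Bi_iff : ∀ ω : BondConfig (Fin n), (∀ v : Fin n, v ≠ s → v ≠ i → v ≠ j → s(s, v) ∉ ω) →
      (ω ∈ Bi ↔ (e₁ ∈ ω) ∨ (e₂ ∈ ω ∧ ω ∈ D)) := fun ω hω => mem_openConn_left_twoPronged his hjs hω
  have Bj_iff : ∀ ω : BondConfig (Fin n), (∀ v : Fin n, v ≠ s → v ≠ i → v ≠ j → s(s, v) ∉ ω) →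
      (ω ∈ Bj ↔ (e₂ ∈ ω) ∨ (e₁ ∈ ω ∧ ω ∈ D)) := fun ω hω => mem_openConn_right_twoPronged his hjs hω
  have A00 : ∀ ω ∈ G00, ω ∉ A := by
    intro ω hω hωA
    apply hbot
    have hcl : openCluster ω s = {s} := by
      ext y
      simp only [openCluster, Set.mem_setOf_eq, Set.mem_singleton_iff]
      constructor
      · intro hy
        by_contra hys
        have h := (reach_twoPronged (ω := ω) his hjs (rootfree 0 0 ω hω) hys).1 hy
        rcases h with ⟨h1, _⟩ | ⟨h2, _⟩
        · exact nmem_zero₁ 0 ω hω h1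
        · exact nmem_zero 0 ω hω h2
      · intro hy; subst hy; exact SimpleGraph.Reachable.refl _
    have : openCluster ω s ∈ 𝒜 := hωA
    rwa [hcl] at this
  have clus_ins : ∀ {e : Sym2 (Fin n)}, (e = e₁ ∨ e = e₂) → ∀ ω : BondConfig (Fin n),
      (∀ v : Fin n, v ≠ s → v ≠ i → v ≠ j → s(s, v) ∉ ω) → (e₁ ∈ insert e ω) → (e₂ ∈ insert e ω) → (e₁ ∈ ω ∨ e₂ ∈ ω) → ω ∈ D →
        openCluster (insert e ω) s = openCluster ω s := by
    intro e he ω hω h1' h2' hopen hωD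
    have hω' : ∀ v : Fin n, v ≠ s → v ≠ i → v ≠ j → s(s, v) ∉ insert e ω := by
      intro v hvs hvi hvj habs
      rcases Set.mem_insert_iff.1 habs with h | h
      · rcases he with rfl | rfl
        · exact (other_ne v hvi hvj).1 h
        · exact (other_ne v hvi hvj).2 h
      · exact hω v hvs hvi hvj h
    have hDω : (openGraph (ω \ {e₁, e₂})).Reachable i j := hωD
    ext y
    by_cases hys : y = s
    · subst hys; simp
    simp only [openCluster, Set.mem_setOf_eq]
    rw [reach_twoPronged (ω := insert e ω) his hjs hω' hys, reach_twoPronged (ω := ω) his hjs hω hys,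
      insert_diff_rootPairs he]
    constructor
    · rintro (⟨_, hr⟩ | ⟨_, hr⟩)
      · rcases hopen with h1 | h2
        · exact Or.inl ⟨h1, hr⟩
        · exact Or.inr ⟨h2, hDω.symm.trans hr⟩
      · rcases hopen with h1 | h2
        · exact Or.inl ⟨h1, hDω.trans hr⟩
        · exact Or.inr ⟨h2, hr⟩
    · rintro (⟨_, hr⟩ | ⟨_, hr⟩)
      · exact Or.inl ⟨h1', hr⟩
      · exact Or.inr ⟨h2', hr⟩
  have cpl₂ : ∀ X : Set (BondConfig (Fin n)), P11.real X = P10.real ((fun ω : BondConfig (Fin n) => insert e₂ ω) ⁻¹' X) :=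
    fun X => by rw [hP11, hP10]; exact pin₂_real_one_one_eq_one_zero w e₁ e₂ X
  have cpl₁ : ∀ X : Set (BondConfig (Fin n)), P11.real X = P01.real ((fun ω : BondConfig (Fin n) => insert e₁ ω) ⁻¹' X) :=
    fun X => by rw [hP11, hP01]; exact pin₂_real_one_one_eq_zero_one w hne X
  set A' := P10.real (A ∩ D) with hA'
  set X := P10.real (A \ D) with hX
  set Y := P01.real (A \ D) with hY
  set M := P11.real (A \ D) with hM
  set u := P10.real D with hu
  have hm : ∀ Z : Set (BondConfig (Fin n)), MeasurableSet Z := fun _ => MeasurableSet.of_discrete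
  have splitA10 : P10.real A = A' + X := by rw [hA', hX, measureReal_inter_add_sdiff (hm D)]
  have splitA01 : P01.real A = P01.real (A ∩ D) + Y := by rw [hY, measureReal_inter_add_sdiff (hm D)]
  have splitA11 : P11.real A = P11.real (A ∩ D) + M := by rw [hM, measureReal_inter_add_sdiff (hm D)]
  have hD11 : P11.real D = u := by
    rw [cpl₂]; congr 1; ext ω; exact hDins (Or.inr rfl) ω
  have hD01 : P01.real D = u := by
    rw [← hD11, cpl₁]; congr 1; ext ω; exact (hDins (Or.inl rfl) ω).symm
  have hAD11 : P11.real (A ∩ D) = A' := by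
    rw [cpl₂, hA']
    refine real_congr_on_sure s10 fun ω hω => ?_
    simp only [Set.mem_preimage, Set.mem_inter_iff]
    rw [hDins (Or.inr rfl) ω]
    constructor
    · rintro ⟨hAi, hDm⟩
      refine ⟨?_, hDm⟩
      have hcl := clus_ins (Or.inr rfl) ω (rootfree 1 0 ω hω) (Set.mem_insert_of_mem _ (mem_one₁ 0 ω hω)) (Set.mem_insert _ _)
        (Or.inl (mem_one₁ 0 ω hω)) hDm
      simp only [hA, Set.mem_setOf_eq] at hAi ⊢; rwa [hcl] at hAi
    · rintro ⟨hAm, hDm⟩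
      refine ⟨?_, hDm⟩
      have hcl := clus_ins (Or.inr rfl) ω (rootfree 1 0 ω hω) (Set.mem_insert_of_mem _ (mem_one₁ 0 ω hω)) (Set.mem_insert _ _)
        (Or.inl (mem_one₁ 0 ω hω)) hDm
      simp only [hA, Set.mem_setOf_eq] at hAm ⊢; rwa [hcl]
  have hAD01 : P01.real (A ∩ D) = A' := by
    rw [← hAD11, cpl₁]
    refine real_congr_on_sure s01 fun ω hω => ?_
    simp only [Set.mem_preimage, Set.mem_inter_iff]
    rw [hDins (Or.inl rfl) ω]
    constructor
    · rintro ⟨hAm, hDm⟩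
      refine ⟨?_, hDm⟩
      have hcl := clus_ins (Or.inl rfl) ω (rootfree 0 1 ω hω) (Set.mem_insert _ _) (Set.mem_insert_of_mem _ (mem_one 0 ω hω))
        (Or.inr (mem_one 0 ω hω)) hDm
      simp only [hA, Set.mem_setOf_eq] at hAm ⊢; rwa [hcl]
    · rintro ⟨hAi, hDm⟩
      refine ⟨?_, hDm⟩
      have hcl := clus_ins (Or.inl rfl) ω (rootfree 0 1 ω hω) (Set.mem_insert _ _) (Set.mem_insert_of_mem _ (mem_one 0 ω hω))
        (Or.inr (mem_one 0 ω hω)) hDm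
      simp only [hA, Set.mem_setOf_eq] at hAi ⊢; rwa [hcl] at hAi
  have hMX : X ≤ M := by
    rw [hM, cpl₂, hX]
    refine measureReal_mono (fun ω hω => ?_)
    simp only [Set.mem_preimage, Set.mem_sdiff] at hω ⊢
    exact ⟨hAup (Set.subset_insert _ _) hω.1, fun h => hω.2 ((hDins (Or.inr rfl) ω).1 h)⟩
  have hMY : Y ≤ M := by
    rw [hM, cpl₁, hY]
    refine measureReal_mono (fun ω hω => ?_)
    simp only [Set.mem_preimage, Set.mem_sdiff] at hω ⊢
    exact ⟨hAup (Set.subset_insert _ _) hω.1, fun h => hω.2 ((hDins (Or.inl rfl) ω).1 h)⟩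
  have hHar10 : P10.real A * P10.real D ≤ P10.real (A ∩ D) := prodBernoulli_harris _ hAup hDup (hm A) (hm D)
  have hHar01 : P01.real A * P01.real D ≤ P01.real (A ∩ D) := prodBernoulli_harris _ hAup hDup (hm A) (hm D)
  rw [splitA10] at hHar10
  rw [splitA01, hAD01, hD01] at hHar01
  have hH1 : u * X ≤ (1 - u) * A' := by nlinarith [hHar10]
  have hH2 : u * Y ≤ (1 - u) * A' := by nlinarith [hHar01]
  have v10_1 : P10.real (A ∩ Bi ∩ Bj) = A' := by
    rw [hA']; refine real_congr_on_sure s10 fun ω hω => ?_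
    simp only [Set.mem_inter_iff]
    rw [Bi_iff ω (rootfree 1 0 ω hω), Bj_iff ω (rootfree 1 0 ω hω)]
    have h1 := mem_one₁ 0 ω hω; have h2 := nmem_zero 1 ω hω
    constructor
    · rintro ⟨⟨hA, _⟩, hB⟩
      rcases hB with h | ⟨_, hd⟩
      · exact absurd h h2
      · exact ⟨hA, hd⟩
    · rintro ⟨hA, hd⟩; exact ⟨⟨hA, Or.inl h1⟩, Or.inr ⟨h1, hd⟩⟩
  have v10_2 : P10.real (A ∩ Bi) = A' + X := by
    rw [← splitA10]; refine real_congr_on_sure s10 fun ω hω => ?_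
    simp only [Set.mem_inter_iff]
    rw [Bi_iff ω (rootfree 1 0 ω hω)]
    exact ⟨fun h => h.1, fun h => ⟨h, Or.inl (mem_one₁ 0 ω hω)⟩⟩
  have v10_3 : P10.real (A ∩ Bj) = A' := by
    rw [hA']; refine real_congr_on_sure s10 fun ω hω => ?_
    simp only [Set.mem_inter_iff]
    rw [Bj_iff ω (rootfree 1 0 ω hω)]
    have h1 := mem_one₁ 0 ω hω; have h2 := nmem_zero 1 ω hω
    constructor
    · rintro ⟨hA, hB⟩
      rcases hB with h | ⟨_, hd⟩
      · exact absurd h h2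
      · exact ⟨hA, hd⟩
    · rintro ⟨hA, hd⟩; exact ⟨hA, Or.inr ⟨h1, hd⟩⟩
  have v10_5 : P10.real Bi = 1 := by
    rw [← probReal_univ (μ := P10)]
    refine real_congr_on_sure s10 fun ω hω => ?_
    simp only [Set.mem_univ, iff_true]
    rw [Bi_iff ω (rootfree 1 0 ω hω)]; exact Or.inl (mem_one₁ 0 ω hω)
  have v10_6 : P10.real Bj = u := by
    rw [hu]; refine real_congr_on_sure s10 fun ω hω => ?_
    rw [Bj_iff ω (rootfree 1 0 ω hω)]
    have h1 := mem_one₁ 0 ω hω; have h2 := nmem_zero 1 ω hω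
    constructor
    · rintro (h | ⟨_, hd⟩)
      · exact absurd h h2
      · exact hd
    · intro hd; exact Or.inr ⟨h1, hd⟩
  have v10_7 : P10.real (Bi ∩ Bj) = u := by
    rw [hu]; refine real_congr_on_sure s10 fun ω hω => ?_
    simp only [Set.mem_inter_iff]
    rw [Bi_iff ω (rootfree 1 0 ω hω), Bj_iff ω (rootfree 1 0 ω hω)]
    have h1 := mem_one₁ 0 ω hω; have h2 := nmem_zero 1 ω hω
    constructor
    · rintro ⟨_, hB⟩
      rcases hB with h | ⟨_, hd⟩
      · exact absurd h h2
      · exact hd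
    · intro hd; exact ⟨Or.inl h1, Or.inr ⟨h1, hd⟩⟩
  have v01_1 : P01.real (A ∩ Bi ∩ Bj) = A' := by
    rw [← hAD01]; refine real_congr_on_sure s01 fun ω hω => ?_
    simp only [Set.mem_inter_iff]
    rw [Bi_iff ω (rootfree 0 1 ω hω), Bj_iff ω (rootfree 0 1 ω hω)]
    have h1 := nmem_zero₁ 1 ω hω; have h2 := mem_one 0 ω hω
    constructor
    · rintro ⟨⟨hA, hB⟩, _⟩
      rcases hB with h | ⟨_, hd⟩
      · exact absurd h h1
      · exact ⟨hA, hd⟩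
    · rintro ⟨hA, hd⟩; exact ⟨⟨hA, Or.inr ⟨h2, hd⟩⟩, Or.inl h2⟩
  have v01_2 : P01.real (A ∩ Bi) = A' := by
    rw [← hAD01]; refine real_congr_on_sure s01 fun ω hω => ?_
    simp only [Set.mem_inter_iff]
    rw [Bi_iff ω (rootfree 0 1 ω hω)]
    have h1 := nmem_zero₁ 1 ω hω; have h2 := mem_one 0 ω hω
    constructor
    · rintro ⟨hA, hB⟩
      rcases hB with h | ⟨_, hd⟩
      · exact absurd h h1
      · exact ⟨hA, hd⟩
    · rintro ⟨hA, hd⟩; exact ⟨hA, Or.inr ⟨h2, hd⟩⟩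
  have v01_3 : P01.real (A ∩ Bj) = A' + Y := by
    rw [← hAD01, ← splitA01]; refine real_congr_on_sure s01 fun ω hω => ?_
    simp only [Set.mem_inter_iff]
    rw [Bj_iff ω (rootfree 0 1 ω hω)]
    exact ⟨fun h => h.1, fun h => ⟨h, Or.inl (mem_one 0 ω hω)⟩⟩
  have v01_4 : P01.real A = A' + Y := by rw [← hAD01, ← splitA01]
  have v01_5 : P01.real Bi = u := by
    rw [← hD01]; refine real_congr_on_sure s01 fun ω hω => ?_
    rw [Bi_iff ω (rootfree 0 1 ω hω)]
    have h1 := nmem_zero₁ 1 ω hω; have h2 := mem_one 0 ω hω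
    constructor
    · rintro (h | ⟨_, hd⟩)
      · exact absurd h h1
      · exact hd
    · intro hd; exact Or.inr ⟨h2, hd⟩
  have v01_6 : P01.real Bj = 1 := by
    rw [← probReal_univ (μ := P01)]
    refine real_congr_on_sure s01 fun ω hω => ?_
    simp only [Set.mem_univ, iff_true]
    rw [Bj_iff ω (rootfree 0 1 ω hω)]; exact Or.inl (mem_one 0 ω hω)
  have v01_7 : P01.real (Bi ∩ Bj) = u := by
    rw [← hD01]; refine real_congr_on_sure s01 fun ω hω => ?_
    simp only [Set.mem_inter_iff]
    rw [Bi_iff ω (rootfree 0 1 ω hω), Bj_iff ω (rootfree 0 1 ω hω)]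
    have h1 := nmem_zero₁ 1 ω hω; have h2 := mem_one 0 ω hω
    constructor
    · rintro ⟨hB, _⟩
      rcases hB with h | ⟨_, hd⟩
      · exact absurd h h1
      · exact hd
    · intro hd; exact ⟨Or.inr ⟨h2, hd⟩, Or.inl h2⟩
  have v11_B : ∀ ω ∈ G11, ω ∈ Bi ∧ ω ∈ Bj := by
    intro ω hω
    rw [Bi_iff ω (rootfree 1 1 ω hω), Bj_iff ω (rootfree 1 1 ω hω)]
    exact ⟨Or.inl (mem_one₁ 1 ω hω), Or.inl (mem_one 1 ω hω)⟩
  have v11_1 : P11.real (A ∩ Bi ∩ Bj) = A' + M := by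
    rw [← hAD11, ← splitA11]; refine real_congr_on_sure s11 fun ω hω => ?_
    simp only [Set.mem_inter_iff]
    exact ⟨fun h => h.1.1, fun h => ⟨⟨h, (v11_B ω hω).1⟩, (v11_B ω hω).2⟩⟩
  have v11_2 : P11.real (A ∩ Bi) = A' + M := by
    rw [← hAD11, ← splitA11]; refine real_congr_on_sure s11 fun ω hω => ?_
    simp only [Set.mem_inter_iff]
    exact ⟨fun h => h.1, fun h => ⟨h, (v11_B ω hω).1⟩⟩
  have v11_3 : P11.real (A ∩ Bj) = A' + M := by
    rw [← hAD11, ← splitA11]; refine real_congr_on_sure s11 fun ω hω => ?_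
    simp only [Set.mem_inter_iff]
    exact ⟨fun h => h.1, fun h => ⟨h, (v11_B ω hω).2⟩⟩
  have v11_4 : P11.real A = A' + M := by rw [← hAD11, ← splitA11]
  have v11_5 : P11.real Bi = 1 := by
    rw [← probReal_univ (μ := P11)]
    refine real_congr_on_sure s11 fun ω hω => ?_
    simp only [Set.mem_univ, iff_true]; exact (v11_B ω hω).1
  have v11_6 : P11.real Bj = 1 := by
    rw [← probReal_univ (μ := P11)]
    refine real_congr_on_sure s11 fun ω hω => ?_
    simp only [Set.mem_univ, iff_true]; exact (v11_B ω hω).2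
  have v11_7 : P11.real (Bi ∩ Bj) = 1 := by
    rw [← probReal_univ (μ := P11)]
    refine real_congr_on_sure s11 fun ω hω => ?_
    simp only [Set.mem_inter_iff, Set.mem_univ, iff_true]; exact v11_B ω hω
  have v00_B : ∀ ω ∈ G00, ω ∉ Bi ∧ ω ∉ Bj := by
    intro ω hω
    rw [Bi_iff ω (rootfree 0 0 ω hω), Bj_iff ω (rootfree 0 0 ω hω)]
    have h1 := nmem_zero₁ 0 ω hω; have h2 := nmem_zero 0 ω hω
    exact ⟨fun h => h.elim h1 (fun h' => h2 h'.1), fun h => h.elim h2 (fun h' => h1 h'.1)⟩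
  have zero00 : ∀ Z : Set (BondConfig (Fin n)), (∀ ω ∈ G00, ω ∉ Z) → P00.real Z = 0 := by
    intro Z hZ
    have h0 : P00.real (∅ : Set (BondConfig (Fin n))) = 0 := by simp
    rw [← h0]
    refine real_congr_on_sure s00 fun ω hω => ?_
    simp only [Set.mem_empty_iff_false, iff_false]; exact hZ ω hω
  have v00_1 : P00.real (A ∩ Bi ∩ Bj) = 0 := zero00 _ fun ω hω h => (v00_B ω hω).1 h.1.2
  have v00_2 : P00.real (A ∩ Bi) = 0 := zero00 _ fun ω hω h => (v00_B ω hω).1 h.2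
  have v00_3 : P00.real (A ∩ Bj) = 0 := zero00 _ fun ω hω h => (v00_B ω hω).2 h.2
  have v00_4 : P00.real A = 0 := zero00 _ fun ω hω h => A00 ω hω h
  have v00_5 : P00.real Bi = 0 := zero00 _ fun ω hω h => (v00_B ω hω).1 h
  have v00_6 : P00.real Bj = 0 := zero00 _ fun ω hω h => (v00_B ω hω).2 h
  have v00_7 : P00.real (Bi ∩ Bj) = 0 := zero00 _ fun ω hω h => (v00_B ω hω).1 h.1
  have hA'0 : 0 ≤ A' := measureReal_nonneg
  have hX0 : 0 ≤ X := measureReal_nonneg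
  have hY0 : 0 ≤ Y := measureReal_nonneg
  have hu0 : 0 ≤ u := measureReal_nonneg
  have hu1 : u ≤ 1 := measureReal_le_one
  rw [real_twoBondDecomp w hne (A ∩ Bi ∩ Bj), real_twoBondDecomp w hne (A ∩ Bi), real_twoBondDecomp w hne (A ∩ Bj),
    real_twoBondDecomp w hne A, real_twoBondDecomp w hne Bi, real_twoBondDecomp w hne Bj, real_twoBondDecomp w hne (Bi ∩ Bj)]
  simp only [← ha, ← hb]
  rw [v00_1, v00_2, v00_3, v00_4, v00_5, v00_6, v00_7, v01_1, v01_2, v01_3, v01_4, v01_5, v01_6, v01_7,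
    v10_1, v10_2, v10_3, splitA10, v10_5, v10_6, v10_7, v11_1, v11_2, v11_3, v11_4, v11_5, v11_6, v11_7]
  have core := wdom_twoPronged_core a b u A' X Y M (a + (1 - a) * b * u) (b + a * (1 - b) * u)
    (a * b + (a * (1 - b) + (1 - a) * b) * u) _ _ rfl rfl rfl rfl rfl ha0 ha1 hb0 hb1 hu0 hu1 hA'0 hX0 hY0 hH1 hH2 hMX hMY
  refine le_of_le_of_eq core ?_
  ring
end IncStar
end Summit.CriticalPhenomena.PercolationContinuityZ3.Theorems
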